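import Summits.QuantumFields.YangMills.Theorems.FlatTubeReductionPinnedUnitStepExDoor
import Summits.QuantumFields.YangMills.Theorems.FlatTubeReductionDecimationWInj
import HarnessLib

/-!
# Route `FlatTubeReduction`, crux `PinnedUnitStepEx` (stmt-QuantumFields-27561), line «ti-split-1» — STUB 1 `stub_smearVarPosGS1`

Seat ym-line-fcl-p3 g9 (2026-08-28).  The registered stub `stub_smearVarPosGS1 : SmearVarPosGS1` of skeleton «ti-split-1» v2
(planner ym-idea-1 g6; stub Props imported from `FlatTubeReductionPinnedUnitStepExDefs`): regime-free strict positivity `⟨f̄Ω, Ω⟩² < ‖f̄Ω‖²`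
of the translation-smeared unit-step trial for the positive normalised physical pointwise coarse ground state `Ω′` and a translation-invariant
normalised physical `φ′ ⊥ Ω′`.
Proof = W-inj(m = 1) `wInjUnit_holds : WInjUnit` (the `SU(2)` instance of `Decimation.ae_eq_const_of_smear_ae_const`: Hoeffding decomposition +
decimation combinatorics, files `FlatTubeReductionDecimation*.lean`) fed to the door `smearVarPosGS1_of_wInjUnit` (ground-state uniqueness and
translation invariance of `Ω′`, Cauchy–Schwarz defect).
R2b1 RECORD rung; closes no item by itself (the crux also needs `stub_pinnedAutocorrExTI1`).
-/

namespace Summit.QuantumFields.YangMills.Cruxes.PinnedUnitStepEx.TISplit1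

open MeasureTheory
open Summit.QuantumFields.YangMills.Theorems.FemtoTransferGap
open Summit.QuantumFields.YangMills.Theorems.FlatTubeReduction.Decimation

/-- **W-inj(m = 1)** (`WInjUnit`, the reduction target of `stub_smearVarPosGS1`, blueprint v2 §E2): the translation-smeared unit
decimation pull-back `g ↦ Σ_v g ∘ thin L' ∘ τ_v` maps no non-constant bounded measurable gauge- and translation-invariant `SU(2)` observable
to an a.e. constant. [folklore] -/
theorem wInjUnit_holds : WInjUnit := by
  intro L' _ g hg hC hGI hTI hnc c hS
  haveI : SecondCountableTopology (Matrix (Fin 2) (Fin 2) ℂ) :=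
    inferInstanceAs (SecondCountableTopology (Fin 2 → Fin 2 → ℂ))
  haveI : SecondCountableTopology SU2 := TopologicalSpace.Subtype.secondCountableTopology _
  obtain ⟨C, hC⟩ := hC
  exact hnc _ (ae_eq_const_of_smear_ae_const hg hC hGI hTI hS)

/-- **STUB 1 of line «ti-split-1»** (`SmearVarPosGS1`, registered signature verbatim): the smeared unit-step trial variance is strictly positive.
[folklore] -/
theorem stub_smearVarPosGS1 : SmearVarPosGS1 :=
  smearVarPosGS1_of_wInjUnit wInjUnit_holds

end Summit.QuantumFields.YangMills.Cruxes.PinnedUnitStepEx.TISplit1
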